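import Summits.CriticalPhenomena.PercolationContinuityZ3.Theorems.SahiMasterFamilyPinningAllOrders

/-!
# A member equal to a coordinate event: `E_{m+1}(μ_p; 1_{{e∈ω}}, 1_{U'})` reduces to the sub-families of the `1`-sections, every order

Unit `prim-master-conj` (crux anchor stmt-CriticalPhenomena-4575, helper work), gen 16; memo
`run/shared/lean/prim/prim-l12/prim-master-conj/POINTWISE.md` §17.  The case `C = Ω` of conjunctive pinning (`…PinningAllOrders`): the minor's sub-family
functionals `E(μ_p; 1_Ω, 1_{(U'¹)_A})` collapse by the branching identity `E_{r+1}(1, g) = (r−1)·E_r(g)` [Sahi2008, Thm. 6], so (`sahiE_ind_coordMember_eq`)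

  `E_{m+1}(μ_p; 1_{{e∈ω}}, 1_{U'}) = t·( (m−1)·E_m(μ_p;1_{U'¹}) + [m = 0] + Σ_A W_p(U'_A)·( (|Aᶜ|−1)·E_{|Aᶜ|}(μ_p; 1_{(U'¹)_{Aᶜ}}) + [Aᶜ = ∅] ) )`,

`W_p = −E(μ_p − μ_{p[e↦1]}; ·) ≥ 0` on increasing families.  Consequences: **`C` and settledness for `({e∈ω}, U')` follow from the sub-families of `U'¹` of size
`≥ 2` — one order LOWER than for a general pinned member** (`sahiE_ind_coordMember_nonneg`, `sahiE_ind_coordMember_settled`).  Order 3 is unconditional: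
`E_3(μ_p; 1_{{e∈ω}}, 1_A, 1_B) = t·(Cov(A¹,B¹) + W_p(A,B)) ≥ 0` for ALL increasing `A, B` (depending on `e` arbitrarily) — the all-`e`-dependence form of the
cylinder-member stratum; order 4 needs only `E_3(A¹,B¹,C¹) ≥ 0` and the three covariances.
HONEST FRAMING: closure properties; nothing is asserted about `C_k` / `MasterFamilyEqIff k` in general.  Axioms standard. [this work]
-/

noncomputable section

open scoped Classical

namespace Summit.CriticalPhenomena.PercolationContinuityZ3.Theorems

open Finset Function
open Literature.Combinatorics.Sahi2008
open Literature.Probability.Percolation.DecisionTree (ind ind_of_mem ind_of_not_mem ind_nonneg)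

namespace Pinning

variable {ι : Type} [Fintype ι]

/-- **Branching, uniform in the order**: `E_{r+1}(μ; 1, g) = (r − 1)·E_r(μ; g) + [r = 0]` for a probability weight (Sahi's `E_n(f,1) = (n−2)E_{n−1}(f)`;
at `r = 0`, `E_1(1) = 1`). [cite: Sahi2008, Thm. 6 (p. 214)] -/
theorem sahiE_one_cons_ite (p : ι → unitInterval) {r : ℕ} (g : Fin r → Set ι → ℝ) :
    sahiE (bernoulliWeight p) (r + 1) (Matrix.vecCons 1 g : Fin (r + 1) → Set ι → ℝ) =
      ((r : ℝ) - 1) * sahiE (bernoulliWeight p) r g + (if r = 0 then 1 else 0) := by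
  cases r with
  | zero => simp [sahiE_one_apply, sahiE_zero, ex_one (sum_bernoulliWeight p)]
  | succ r =>
    rw [sahiE_one_cons (sum_bernoulliWeight p), if_neg (Nat.succ_ne_zero r)]
    push_cast; ring

section Member

variable (p : ι → unitInterval) (e : ι) {m : ℕ} (U' : Fin m → Set (Set ι))

/-- **A coordinate-event member, every order (identity).**  For ANY events `U'` and any `p`, with `t = p_e`, `X¹ = secAt e true X`, `σ = μ_p − μ_{p[e↦1]}`:
`E_{m+1}(μ_p; 1_{{e∈ω}}, 1_{U'}) = t·( (m−1)E_m(μ_p;1_{U'¹}) + [m=0] − Σ_A E_{|A|}(σ;1_{U'_A})·((|Aᶜ|−1)E_{|Aᶜ|}(μ_p;1_{(U'¹)_{Aᶜ}}) + [Aᶜ=∅]) )`. [this work] -/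
theorem sahiE_ind_coordMember_eq :
    sahiE (bernoulliWeight p) (m + 1) (Matrix.vecCons (ind {ω : Set ι | e ∈ ω}) (fun j => ind (U' j)) : Fin (m + 1) → Set ι → ℝ) =
      (p e : ℝ) *
        ((((m : ℝ) - 1) * sahiE (bernoulliWeight p) m (fun j => ind (secAt e true (U' j))) + (if m = 0 then 1 else 0)) -
          ∑ A : Finset (Fin m),
            sahiE (bernoulliWeight p - bernoulliWeight (update p e 1)) A.card (fun j => ind (U' (A.orderEmbOfFin rfl j))) *
              ((((Aᶜ.card : ℕ) : ℝ) - 1) * sahiE (bernoulliWeight p) Aᶜ.card (fun j => ind (secAt e true (U' (Aᶜ.orderEmbOfFin rfl j)))) +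
                (if Aᶜ.card = 0 then 1 else 0))) := by
  have hfree : ∀ b : Bool, secAt e b (Set.univ : Set (Set ι)) = Set.univ := fun b => by ext ω; simp [mem_secAt]
  have h := sahiE_ind_pin_eq p e m Set.univ hfree U'
  rw [Set.univ_inter] at h
  rw [h, ind_univ_eq_one, sahiE_one_cons_ite]
  simp only [sahiE_one_cons_ite]

/-- **Positivity from the sub-families of the `1`-sections of size `≥ 2`.**  If the `U'_j` are increasing and `E_{|B|}(μ_p; 1_{(U'¹)_B}) ≥ 0` for every set
of slots `B` with `|B| ≥ 2`, then `E_{m+1}(μ_p; 1_{{e∈ω}}, 1_{U'}) ≥ 0`. [this work] -/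
theorem sahiE_ind_coordMember_nonneg (hU' : ∀ j, IsUpperSet (U' j))
    (H : ∀ B : Finset (Fin m), 2 ≤ B.card → 0 ≤ sahiE (bernoulliWeight p) B.card (fun j => ind (secAt e true (U' (B.orderEmbOfFin rfl j))))) :
    0 ≤ sahiE (bernoulliWeight p) (m + 1) (Matrix.vecCons (ind {ω : Set ι | e ∈ ω}) (fun j => ind (U' j)) : Fin (m + 1) → Set ι → ℝ) := by
  have ht : 0 ≤ (p e : ℝ) := (p e).2.1
  -- the bracket `(r - 1)·E_r(V) + [r = 0]` is nonnegative for every sub-family `V` of `U'¹`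
  have aux : ∀ (r : ℕ) (g : Fin r → Set ι → ℝ), r < 2 →
      0 ≤ ((r : ℝ) - 1) * sahiE (bernoulliWeight p) r g + (if r = 0 then 1 else 0) := by
    intro r g hr
    interval_cases r
    · simp [sahiE_zero]
    · simp
  have hbr : ∀ B : Finset (Fin m), 0 ≤ (((B.card : ℕ) : ℝ) - 1) *
      sahiE (bernoulliWeight p) B.card (fun j => ind (secAt e true (U' (B.orderEmbOfFin rfl j)))) + (if B.card = 0 then 1 else 0) := by
    intro B
    rcases Nat.lt_or_ge B.card 2 with hlt | hge
    · exact aux _ _ hlt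
    · rw [if_neg (by omega), add_zero]
      have h2 : (2 : ℝ) ≤ (B.card : ℝ) := by exact_mod_cast hge
      exact mul_nonneg (by linarith) (H B hge)
  have hfull : 0 ≤ (((m : ℝ) - 1) * sahiE (bernoulliWeight p) m (fun j => ind (secAt e true (U' j))) + (if m = 0 then 1 else 0)) := by
    have h := hbr univ
    rwa [WeightSum.sahiE_sub_univ (bernoulliWeight p) (fun j => ind (secAt e true (U' j))), Finset.card_univ, Fintype.card_fin] at h
  have hsum : ∑ A : Finset (Fin m),
      sahiE (bernoulliWeight p - bernoulliWeight (update p e 1)) A.card (fun j => ind (U' (A.orderEmbOfFin rfl j))) *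
        ((((Aᶜ.card : ℕ) : ℝ) - 1) * sahiE (bernoulliWeight p) Aᶜ.card (fun j => ind (secAt e true (U' (Aᶜ.orderEmbOfFin rfl j)))) +
          (if Aᶜ.card = 0 then 1 else 0)) ≤ 0 :=
    Finset.sum_nonpos fun A _ => mul_nonpos_of_nonpos_of_nonneg
      (sahiE_signedWeight_nonpos p e (fun j => U' (A.orderEmbOfFin rfl j)) fun j => hU' _) (hbr Aᶜ)
  rw [sahiE_ind_coordMember_eq p e U']
  exact mul_nonneg ht (by linarith)

/-- **Order three, unconditional**: `E_3(μ_p; 1_{{e∈ω}}, 1_A, 1_B) ≥ 0` for ALL increasing `A, B` (the sub-families of `(A¹, B¹)` of size `2` have `E_2 = Cov ≥ 0`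
by Harris). [this work] -/
theorem sahiE_three_ind_coordMember_nonneg (A B : Set (Set ι)) (hA : IsUpperSet A) (hB : IsUpperSet B) :
    0 ≤ sahiE (bernoulliWeight p) 3 (Matrix.vecCons (ind {ω : Set ι | e ∈ ω}) (fun j => ind (![A, B] j)) : Fin 3 → Set ι → ℝ) := by
  have hAB : ∀ i : Fin 2, IsUpperSet (![A, B] i) := fun i => by fin_cases i <;> simpa
  refine sahiE_ind_coordMember_nonneg p e ![A, B] hAB fun S hS => ?_
  have hV : ∀ j, IsUpperSet (secAt e true (![A, B] (S.orderEmbOfFin rfl j))) := fun j => isUpperSet_secAt e true (hAB _)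
  have hle : S.card ≤ 2 := le_trans (Finset.card_le_univ S) (by simp)
  exact masterFamilyNonneg_of_le_two (le_of_eq (le_antisymm hle hS)) ι p _ hV

end Member

end Pinning

end Summit.CriticalPhenomena.PercolationContinuityZ3.Theorems
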